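import Literature.AnabelianGeometry.SemiGraphs.UniversalCoveringOver
import Literature.AnabelianGeometry.SemiGraphs.OrbitGraphMap

/-!
# Countable disjoint unions of coverings ([SemiAnbd] §3, p. 37: "countable coproducts")

For a countable family `T : ι → B^cov(𝒢)`, the disjoint union `Σ T`: fibres are the disjoint unions
of the fibres, with the summand inclusions `T i ⟶ Σ T`.  The connected components of `Σ T` are
those of the summands (`sameComponent_sigma_iff`), so `Σ T` is tempered if every `T i` is
([SemiAnbd] §3 p. 37: `B^temp(𝒢)` is closed under countable coproducts).  Used to realise an
arbitrary object of `B^temp(π₁^temp(𝒢))` as the fibre of a covering, orbit by orbit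
([SemiAnbd] Prop. 3.6 (ii)).
-/

namespace Literature.AnabelianGeometry.SemiGraphs

namespace ProfiniteSemiGraph

open CategoryTheory

universe u

variable {𝒢 : ProfiniteSemiGraph.{u}} {ι : Type u} [Countable ι] (T : ι → CovObj 𝒢)

/-- The vertex fibre of the disjoint union as a `Π_v`-set. [cite: MochizukiSemiAnbd2006, Def 3.5 p.37] -/
def CovObj.sigmaVAction (v : 𝒢.graph.Vertex) : Action (Type u) (𝒢.Gv v) where
  V := Σ i, ((T i).SV v).obj.V
  ρ :=
    { toFun := fun g => TypeCat.ofHom fun x : Σ i, ((T i).SV v).obj.V => ⟨x.1, ((T x.1).SV v).obj.ρ g x.2⟩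
      map_one' := by
        apply ConcreteCategory.hom_ext
        rintro ⟨i, x⟩
        change (⟨i, ((T i).SV v).obj.ρ 1 x⟩ : Σ i, ((T i).SV v).obj.V) = ⟨i, x⟩
        rw [map_one]; rfl
      map_mul' := fun g g' => by
        apply ConcreteCategory.hom_ext
        rintro ⟨i, x⟩
        change (⟨i, ((T i).SV v).obj.ρ (g * g') x⟩ : Σ i, ((T i).SV v).obj.V) =
          ⟨i, ((T i).SV v).obj.ρ g (((T i).SV v).obj.ρ g' x)⟩
        rw [map_mul]; rfl }

/-- The edge fibre of the disjoint union as a `Π_e`-set. [cite: MochizukiSemiAnbd2006, Def 3.5 p.37] -/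
def CovObj.sigmaEAction (e : 𝒢.graph.Edge) : Action (Type u) (𝒢.Ge e) where
  V := Σ i, ((T i).SE e).obj.V
  ρ :=
    { toFun := fun g => TypeCat.ofHom fun y : Σ i, ((T i).SE e).obj.V => ⟨y.1, ((T y.1).SE e).obj.ρ g y.2⟩
      map_one' := by
        apply ConcreteCategory.hom_ext
        rintro ⟨i, y⟩
        change (⟨i, ((T i).SE e).obj.ρ 1 y⟩ : Σ i, ((T i).SE e).obj.V) = ⟨i, y⟩
        rw [map_one]; rfl
      map_mul' := fun g g' => by
        apply ConcreteCategory.hom_ext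
        rintro ⟨i, y⟩
        change (⟨i, ((T i).SE e).obj.ρ (g * g') y⟩ : Σ i, ((T i).SE e).obj.V) =
          ⟨i, ((T i).SE e).obj.ρ g (((T i).SE e).obj.ρ g' y)⟩
        rw [map_mul]; rfl }

/-- The fibres of the disjoint union are tempered (stabiliser of `⟨i, x⟩` = stabiliser of `x`).
[cite: MochizukiSemiAnbd2006, Def 3.5 p.37] -/
theorem CovObj.sigmaVAction_mem (v : 𝒢.graph.Vertex) : temperedAction (𝒢.Gv v) (CovObj.sigmaVAction T v) := by
  haveI : ∀ i, Countable ((T i).SV v).obj.V := fun i => ((T i).SV v).property.1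
  refine ⟨inferInstanceAs (Countable (Σ i, ((T i).SV v).obj.V)), ?_⟩
  rintro ⟨i, x⟩
  have e : {g : 𝒢.Gv v | (CovObj.sigmaVAction T v).ρ g ⟨i, x⟩ = ⟨i, x⟩} =
      {g : 𝒢.Gv v | ((T i).SV v).obj.ρ g x = x} := by
    ext g
    change (⟨i, ((T i).SV v).obj.ρ g x⟩ : Σ i, ((T i).SV v).obj.V) = ⟨i, x⟩ ↔ ((T i).SV v).obj.ρ g x = x
    constructor
    · intro h; exact eq_of_heq (Sigma.mk.inj h).2
    · intro h; rw [h]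
  change IsOpen {g : 𝒢.Gv v | (CovObj.sigmaVAction T v).ρ g ⟨i, x⟩ = ⟨i, x⟩}
  rw [e]
  exact ((T i).SV v).property.2 x

/-- Edge version. [cite: MochizukiSemiAnbd2006, Def 3.5 p.37] -/
theorem CovObj.sigmaEAction_mem (e : 𝒢.graph.Edge) : temperedAction (𝒢.Ge e) (CovObj.sigmaEAction T e) := by
  haveI : ∀ i, Countable ((T i).SE e).obj.V := fun i => ((T i).SE e).property.1
  refine ⟨inferInstanceAs (Countable (Σ i, ((T i).SE e).obj.V)), ?_⟩
  rintro ⟨i, y⟩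
  have h : {g : 𝒢.Ge e | (CovObj.sigmaEAction T e).ρ g ⟨i, y⟩ = ⟨i, y⟩} =
      {g : 𝒢.Ge e | ((T i).SE e).obj.ρ g y = y} := by
    ext g
    change (⟨i, ((T i).SE e).obj.ρ g y⟩ : Σ i, ((T i).SE e).obj.V) = ⟨i, y⟩ ↔ ((T i).SE e).obj.ρ g y = y
    constructor
    · intro h; exact eq_of_heq (Sigma.mk.inj h).2
    · intro h; rw [h]
  change IsOpen {g : 𝒢.Ge e | (CovObj.sigmaEAction T e).ρ g ⟨i, y⟩ = ⟨i, y⟩}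
  rw [h]
  exact ((T i).SE e).property.2 y

/-- **The disjoint union `Σ T` of a countable family of coverings.** [cite: MochizukiSemiAnbd2006, Def 3.5 p.37] -/
noncomputable def CovObj.sigma : CovObj 𝒢 where
  SV v := ⟨CovObj.sigmaVAction T v, CovObj.sigmaVAction_mem T v⟩
  SE e := ⟨CovObj.sigmaEAction T e, CovObj.sigmaEAction_mem T e⟩
  glue b v h := (temperedAction (𝒢.Ge (𝒢.graph.edgeOf b))).isoMk
    (Action.mkIso (Equiv.toIso (Equiv.sigmaCongrRight fun i =>
      ({ toFun := ((T i).glue b v h).hom.hom.hom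
         invFun := ((T i).glue b v h).inv.hom.hom
         left_inv := (T i).glue_inv_hom b v h
         right_inv := (T i).glue_hom_inv b v h } :
        ((T i).SE (𝒢.graph.edgeOf b)).obj.V ≃ ((T i).SV v).obj.V))) fun g => by
      apply ConcreteCategory.hom_ext
      rintro ⟨i, y⟩
      exact congrArg (Sigma.mk i) ((T i).glue_ρ b v h g y))

/-- The summand inclusions `T i ⟶ Σ T`. [cite: MochizukiSemiAnbd2006, Def 3.5 p.37] -/
noncomputable def CovObj.sigmaIncl (i : ι) : T i ⟶ CovObj.sigma T where
  fV v := ObjectProperty.homMk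
    { hom := TypeCat.ofHom fun x : ((T i).SV v).obj.V => (⟨i, x⟩ : Σ i, ((T i).SV v).obj.V)
      comm := fun _ => rfl }
  fE e := ObjectProperty.homMk
    { hom := TypeCat.ofHom fun y : ((T i).SE e).obj.V => (⟨i, y⟩ : Σ i, ((T i).SE e).obj.V)
      comm := fun _ => rfl }
  comm b v h := by
    apply ObjectProperty.hom_ext
    apply Action.Hom.ext
    apply ConcreteCategory.hom_ext
    intro y
    rfl

/-- A point of the summand `T i` as a point of `Σ T`. [cite: MochizukiSemiAnbd2006, Def 3.5 p.37] -/
def CovObj.sigmaPt (i : ι) : (T i).Point → (CovObj.sigma T).Point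
  | Sum.inl ⟨v, x⟩ => Sum.inl ⟨v, ⟨i, x⟩⟩
  | Sum.inr ⟨e, y⟩ => Sum.inr ⟨e, ⟨i, y⟩⟩

/-- Every point of `Σ T` comes from a summand. [cite: MochizukiSemiAnbd2006, Def 3.5 p.37] -/
theorem CovObj.sigmaPt_surjective (Q : (CovObj.sigma T).Point) : ∃ i q, CovObj.sigmaPt T i q = Q := by
  rcases Q with ⟨v, ⟨i, x⟩⟩ | ⟨e, ⟨i, y⟩⟩
  · exact ⟨i, Sum.inl ⟨v, x⟩, rfl⟩
  · exact ⟨i, Sum.inr ⟨e, y⟩, rfl⟩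

/-- Adjacency in a summand gives adjacency in `Σ T`. [cite: MochizukiSemiAnbd2006, Def 3.5(ii) p.37] -/
theorem CovObj.adj_sigmaPt (i : ι) {p q : (T i).Point} (h : (T i).Adj p q) :
    (CovObj.sigma T).Adj (CovObj.sigmaPt T i p) (CovObj.sigmaPt T i q) := by
  cases h with
  | vertex v g x => exact CovObj.Adj.vertex (S := CovObj.sigma T) v g ⟨i, x⟩
  | edge e g x => exact CovObj.Adj.edge (S := CovObj.sigma T) e g ⟨i, x⟩
  | glue b v hb x => exact CovObj.Adj.glue (S := CovObj.sigma T) b v hb ⟨i, x⟩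

/-- "`Q` comes from the summand `i`, from a point in the component of `p`." [folklore] -/
private def FromComp (i : ι) (p : (T i).Point) (Q : (CovObj.sigma T).Point) : Prop :=
  ∃ q : (T i).Point, CovObj.sigmaPt T i q = Q ∧ (T i).SameComponent p q

/-- `FromComp` is invariant under adjacency in `Σ T`. [folklore] -/
private theorem fromComp_iff_of_adj (i : ι) (p : (T i).Point) {Q Q' : (CovObj.sigma T).Point}
    (h : (CovObj.sigma T).Adj Q Q') : FromComp T i p Q ↔ FromComp T i p Q' := by
  cases h with
  | vertex v g jx =>
    obtain ⟨j, x⟩ := jx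
    constructor
    · rintro ⟨q, hq, hpq⟩
      rcases q with ⟨v', x'⟩ | ⟨e', y'⟩
      · change (Sum.inl ⟨v', ⟨i, x'⟩⟩ : (CovObj.sigma T).Point) = Sum.inl ⟨v, ⟨j, x⟩⟩ at hq
        cases hq
        exact ⟨Sum.inl ⟨v, ((T i).SV v).obj.ρ g x'⟩, rfl,
          Relation.EqvGen.trans _ _ _ hpq (Relation.EqvGen.rel _ _ (CovObj.Adj.vertex v g x'))⟩
      · exact absurd hq (by simp [CovObj.sigmaPt])
    · rintro ⟨q, hq, hpq⟩
      rcases q with ⟨v', x'⟩ | ⟨e', y'⟩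
      · change (Sum.inl ⟨v', ⟨i, x'⟩⟩ : (CovObj.sigma T).Point) = Sum.inl ⟨v, ⟨j, ((T j).SV v).obj.ρ g x⟩⟩ at hq
        cases hq
        refine ⟨Sum.inl ⟨v, x⟩, rfl, Relation.EqvGen.trans _ _ _ hpq
          (Relation.EqvGen.symm _ _ (Relation.EqvGen.rel _ _ (CovObj.Adj.vertex v g x)))⟩
      · exact absurd hq (by simp [CovObj.sigmaPt])
  | edge e g jy =>
    obtain ⟨j, y⟩ := jy
    constructor
    · rintro ⟨q, hq, hpq⟩
      rcases q with ⟨v', x'⟩ | ⟨e', y'⟩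
      · exact absurd hq (by simp [CovObj.sigmaPt])
      · change (Sum.inr ⟨e', ⟨i, y'⟩⟩ : (CovObj.sigma T).Point) = Sum.inr ⟨e, ⟨j, y⟩⟩ at hq
        cases hq
        exact ⟨Sum.inr ⟨e, ((T i).SE e).obj.ρ g y'⟩, rfl,
          Relation.EqvGen.trans _ _ _ hpq (Relation.EqvGen.rel _ _ (CovObj.Adj.edge e g y'))⟩
    · rintro ⟨q, hq, hpq⟩
      rcases q with ⟨v', x'⟩ | ⟨e', y'⟩
      · exact absurd hq (by simp [CovObj.sigmaPt])
      · change (Sum.inr ⟨e', ⟨i, y'⟩⟩ : (CovObj.sigma T).Point) = Sum.inr ⟨e, ⟨j, ((T j).SE e).obj.ρ g y⟩⟩ at hq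
        cases hq
        refine ⟨Sum.inr ⟨e, y⟩, rfl, Relation.EqvGen.trans _ _ _ hpq
          (Relation.EqvGen.symm _ _ (Relation.EqvGen.rel _ _ (CovObj.Adj.edge e g y)))⟩
  | glue b v hb jy =>
    obtain ⟨j, y⟩ := jy
    constructor
    · rintro ⟨q, hq, hpq⟩
      rcases q with ⟨v', x'⟩ | ⟨e', y'⟩
      · exact absurd hq (by simp [CovObj.sigmaPt])
      · change (Sum.inr ⟨e', ⟨i, y'⟩⟩ : (CovObj.sigma T).Point) = Sum.inr ⟨_, ⟨j, y⟩⟩ at hq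
        cases hq
        exact ⟨Sum.inl ⟨v, ((T i).glue b v hb).hom.hom.hom y'⟩, rfl,
          Relation.EqvGen.trans _ _ _ hpq (Relation.EqvGen.rel _ _ (CovObj.Adj.glue b v hb y'))⟩
    · rintro ⟨q, hq, hpq⟩
      rcases q with ⟨v', x'⟩ | ⟨e', y'⟩
      · change (Sum.inl ⟨v', ⟨i, x'⟩⟩ : (CovObj.sigma T).Point) =
          Sum.inl ⟨v, ⟨j, ((T j).glue b v hb).hom.hom.hom y⟩⟩ at hq
        cases hq
        refine ⟨Sum.inr ⟨_, y⟩, rfl, Relation.EqvGen.trans _ _ _ hpq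
          (Relation.EqvGen.symm _ _ (Relation.EqvGen.rel _ _ (CovObj.Adj.glue b v hb y)))⟩
      · exact absurd hq (by simp [CovObj.sigmaPt])

/-- **Components of `Σ T` are components of the summands**: a point of `Σ T` in the component of
a point of `T i` comes from `T i`, from the same component. [cite: MochizukiSemiAnbd2006, Def 3.5(ii) p.37] -/
theorem CovObj.exists_of_sameComponent_sigmaPt (i : ι) (p : (T i).Point) (Q : (CovObj.sigma T).Point)
    (h : (CovObj.sigma T).SameComponent (CovObj.sigmaPt T i p) Q) :
    ∃ q : (T i).Point, CovObj.sigmaPt T i q = Q ∧ (T i).SameComponent p q := by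
  have key : ∀ {A B : (CovObj.sigma T).Point}, (CovObj.sigma T).SameComponent A B →
      (FromComp T i p A ↔ FromComp T i p B) := by
    intro A B hAB
    induction hAB with
    | rel a b hab => exact fromComp_iff_of_adj T i p hab
    | refl a => exact Iff.rfl
    | symm a b _ ih => exact ih.symm
    | trans a b c _ _ ih1 ih2 => exact ih1.trans ih2
  exact (key h).mp ⟨p, rfl, Relation.EqvGen.refl _⟩

/-- Conversely, components of summands map into components of `Σ T`. [cite: MochizukiSemiAnbd2006, Def 3.5(ii) p.37] -/
theorem CovObj.sameComponent_sigmaPt (i : ι) {p q : (T i).Point} (h : (T i).SameComponent p q) :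
    (CovObj.sigma T).SameComponent (CovObj.sigmaPt T i p) (CovObj.sigmaPt T i q) := by
  induction h with
  | rel a b hab => exact Relation.EqvGen.rel _ _ (CovObj.adj_sigmaPt T i hab)
  | refl a => exact Relation.EqvGen.refl _
  | symm a b _ ih => exact Relation.EqvGen.symm _ _ ih
  | trans a b c _ _ ih1 ih2 => exact Relation.EqvGen.trans _ _ _ ih1 ih2

/-- **A countable disjoint union of tempered coverings is tempered.**
[cite: MochizukiSemiAnbd2006, Def 3.5(ii) p.37] -/
theorem CovObj.sigma_isTempered (hT : ∀ i, (T i).IsTempered) : (CovObj.sigma T).IsTempered := by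
  intro P
  obtain ⟨i, p, rfl⟩ := CovObj.sigmaPt_surjective T P
  obtain ⟨F, hfin, hne, hsp⟩ := hT i p
  refine ⟨F, hfin, hne, fun Q hQ => ?_⟩
  obtain ⟨q, rfl, hpq⟩ := CovObj.exists_of_sameComponent_sigmaPt T i p Q hQ
  have hq := hsp q hpq
  rcases q with ⟨v, x⟩ | ⟨e, y⟩
  · intro z g hgz
    exact congrArg (Sigma.mk i) (hq z g hgz)
  · intro z g hgz
    exact congrArg (Sigma.mk i) (hq z g hgz)

end ProfiniteSemiGraph

end Literature.AnabelianGeometry.SemiGraphs
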